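import Summits.Ventures.DiscreteObjects.Hadamard.ConferenceGraph333ExtremalRankTests

/-!
# Orders `14` and `21` with an extremal `7`-part in Aut(srg(333,166,82,83)): rank-test laws (kernel)

Framing: lottery ticket; floor = certified bounds/negative ranges.  Cell pub-namedobj (venture DiscreteObjects),
target (H) = `H(668)`, hadamard gen 32.  Census COROLLARIES of the `p = 7` instance of the general rank tests
(`ConferenceGraph333ExtremalRankTests.aut_order7_fixed25_rank_tests`) for an automorphism `σ` whose `7`-part `ρ = σ²` resp. `σ³` fixes
`25` vertices (the extremal case; `44` orbits of size `7`, corank `19`):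
* **`aut_order14_fixed25_rank`** — `σ^14 = 1`, `#Fix σ² = 25`: `(#Fix σ⁷ − 8·#Fix σ)² ≤ 133²` (trace bound at `j = 1`: a `σ²`-moved `x` has
  `σx ∈ ⟨σ²⟩x` iff `σ⁷x = x`, so `T₁ = #Fix σ⁷ − #Fix σ`, `f₁ = #Fix σ`).  E2 kill: the cycle type `14²²·2²·1²¹` (`#Fix σ = 21`,
  `#Fix σ⁷ = 21`: `|21 − 168| = 147 > 133`).
* **`aut_order21_fixed25_rank`** — `σ^21 = 1`, `#Fix σ³ = 25`: `8·#Fix σ ≤ #Fix σ⁷ + 66` (averaged test: `0 ≤ 7·133 + 14·(#Fix σ⁷ − 8·#Fix σ)`).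
  E2 kill: `21¹⁴·7²·3⁴·1¹³` (`#Fix σ = 13`, `#Fix σ⁷ = 27`: `104 > 93`).
E2: pub-namedobj-hadamard-g31/results/rank_test_general_g31.txt (p = 7, n = 14: 1 kill; n = 21: 1 kill).  WORDS: structure of a HYPOTHETICAL
object (orders `14`, `21` remain admissible); ours (PROVISIONAL).  No `sorry`, no new definitions.
-/

namespace Summit.Ventures.DiscreteObjects.Hadamard

open Finset

section orders1421
variable {V : Type*} [Fintype V] [DecidableEq V]

omit [Fintype V] [DecidableEq V] in
/-- coprime exponents (private copy of the `CompositeOrderTools` lemma). -/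
private lemma perm_fixed_of_pow_coprime_o14 (σ : Equiv.Perm V) {a b : ℕ} (hab : Nat.Coprime a b) (hb : 1 < b)
    {x : V} (ha : (σ ^ a) x = x) (hbx : (σ ^ b) x = x) : σ x = x := by
  obtain ⟨m, -, hm⟩ := Nat.exists_mul_mod_eq_one_of_coprime hab hb
  have h1 : (σ ^ (a * m)) x = x := by rw [pow_mul]; exact Equiv.Perm.pow_apply_eq_self_of_apply_eq_self ha m
  have h2 : (σ ^ (b * (a * m / b))) x = x := by
    rw [pow_mul]; exact Equiv.Perm.pow_apply_eq_self_of_apply_eq_self hbx _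
  have e : a * m = b * (a * m / b) + 1 := by
    have := Nat.div_add_mod (a * m) b
    omega
  rw [e, pow_succ', Equiv.Perm.mul_apply, h2] at h1
  exact h1

/-- **Order `14` with `#Fix σ² = 25`**: `(#Fix σ⁷ − 8·#Fix σ)² ≤ 133²`. -/
theorem aut_order14_fixed25_rank (hV : Fintype.card V = 333) (A : Matrix V V ℤ)
    (h01 : ∀ x y, A x y = 0 ∨ A x y = 1) (hsymm : ∀ x y, A y x = A x y) (hdiag : ∀ x, A x x = 0)
    (hk : ∀ x, ∑ y, A x y = 166) (hsrg : ∀ x y, ∑ z, A x z * A z y = 83 * (1 + (if x = y then 1 else 0)) - A x y)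
    (σ : Equiv.Perm V) (hσ : σ ^ 14 = 1) (hF : (univ.filter fun x => (σ ^ 2) x = x).card = 25)
    (hA : ∀ x y, A (σ x) (σ y) = A x y) :
    (((univ.filter fun x => (σ ^ 7) x = x).card : ℤ) - 8 * ((univ.filter fun x => σ x = x).card : ℤ)) ^ 2 ≤ 133 ^ 2 := by
  have hAk := adj_pow_invariant A σ hA
  have hρ : (σ ^ 2) ^ 7 = 1 := by rw [← pow_mul]; exact hσ
  have hcomm : σ * σ ^ 2 = σ ^ 2 * σ := by rw [← pow_succ', ← pow_succ]
  obtain ⟨h1, -⟩ := aut_order7_fixed25_rank_tests hV A h01 hsymm hdiag hk hsrg (σ ^ 2) hρ (hAk 2) hF σ hcomm hA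
    (by norm_num : 0 < 14) hσ
  have hj := h1 1
  simp only [pow_one] at hj
  have hσx : ∀ x, (σ ^ 14) x = x := fun x => by rw [hσ, Equiv.Perm.one_apply]
  -- a σ²-moved x has σx ∈ ⟨σ²⟩x iff σ⁷ x = x
  have hkey : ∀ x, (σ ^ 2) x ≠ x → (σ x ∈ (Finset.range 7).image (fun k => ((σ ^ 2) ^ k) x) ↔ (σ ^ 7) x = x) := by
    intro x hx
    have step : ∀ a : ℕ, (σ ^ (a + 1)) x = σ x → (σ ^ a) x = x := fun a h => by
      rw [pow_succ', Equiv.Perm.mul_apply] at h; exact σ.injective h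
    have contra : ∀ a : ℕ, Nat.Coprime a 14 → (σ ^ a) x = x → False := fun a ha h =>
      hx (Equiv.Perm.pow_apply_eq_self_of_apply_eq_self (perm_fixed_of_pow_coprime_o14 σ ha (by norm_num) h (hσx x)) 2)
    constructor
    · intro hmem
      obtain ⟨k, hk7, hkx⟩ := Finset.mem_image.mp hmem
      rw [Finset.mem_range] at hk7
      rw [← pow_mul] at hkx
      interval_cases k
      · exfalso; apply hx
        rw [mul_zero, pow_zero, Equiv.Perm.one_apply] at hkx
        exact Equiv.Perm.pow_apply_eq_self_of_apply_eq_self hkx.symm 2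
      · exact (contra 1 (by norm_num) (step 1 hkx)).elim
      · exact (contra 3 (by norm_num) (step 3 hkx)).elim
      · exact (contra 5 (by norm_num) (step 5 hkx)).elim
      · exact step 7 hkx
      · exact (contra 9 (by norm_num) (step 9 hkx)).elim
      · exact (contra 11 (by norm_num) (step 11 hkx)).elim
    · intro h7
      refine Finset.mem_image.mpr ⟨4, Finset.mem_range.mpr (by norm_num), ?_⟩
      show ((σ ^ 2) ^ 4) x = σ x
      rw [← pow_mul, show (2 * 4 : ℕ) = 1 + 7 by norm_num, pow_add, pow_one, Equiv.Perm.mul_apply, h7]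
  have hset : (univ.filter fun x => (σ ^ 2) x ≠ x ∧ σ x ∈ (Finset.range 7).image (fun k => ((σ ^ 2) ^ k) x)) =
      univ.filter fun x => (σ ^ 7) x = x ∧ ¬ (σ ^ 2) x = x :=
    Finset.filter_congr fun x _ => ⟨fun h => ⟨(hkey x h.1).mp h.2, h.1⟩, fun h => ⟨h.2, (hkey x h.2).mpr h.1⟩⟩
  have hfix : (univ.filter fun x => σ x = x ∧ (σ ^ 2) x = x) = univ.filter fun x => σ x = x :=
    Finset.filter_congr fun x _ => ⟨fun h => h.1, fun h => ⟨h, Equiv.Perm.pow_apply_eq_self_of_apply_eq_self h 2⟩⟩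
  have hfix2 : (univ.filter fun x => (σ ^ 7) x = x ∧ (σ ^ 2) x = x) = univ.filter fun x => σ x = x := by
    refine Finset.filter_congr fun x _ => ⟨fun h => perm_fixed_of_pow_coprime_o14 σ (by norm_num : Nat.Coprime 7 2)
      (by norm_num) h.1 h.2, fun h => ⟨Equiv.Perm.pow_apply_eq_self_of_apply_eq_self h 7,
        Equiv.Perm.pow_apply_eq_self_of_apply_eq_self h 2⟩⟩
  have hsplit := Finset.card_filter_add_card_filter_not (s := univ.filter fun x => (σ ^ 7) x = x) (fun x => (σ ^ 2) x = x)
  rw [Finset.filter_filter, Finset.filter_filter, hfix2] at hsplit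
  rw [hset, hfix] at hj
  rw [← hsplit, Nat.cast_add]
  have e : (((univ.filter fun x => σ x = x).card : ℤ) + ((univ.filter fun x => (σ ^ 7) x = x ∧ ¬ (σ ^ 2) x = x).card : ℤ)
      - 8 * ((univ.filter fun x => σ x = x).card : ℤ)) =
      (((univ.filter fun x => (σ ^ 7) x = x ∧ ¬ (σ ^ 2) x = x).card : ℤ) - 7 * ((univ.filter fun x => σ x = x).card : ℤ)) := by
    ring
  rw [e]
  exact hj

/-- **Order `21` with `#Fix σ³ = 25`**: `8·#Fix σ ≤ #Fix σ⁷ + 66`. -/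
theorem aut_order21_fixed25_rank (hV : Fintype.card V = 333) (A : Matrix V V ℤ)
    (h01 : ∀ x y, A x y = 0 ∨ A x y = 1) (hsymm : ∀ x y, A y x = A x y) (hdiag : ∀ x, A x x = 0)
    (hk : ∀ x, ∑ y, A x y = 166) (hsrg : ∀ x y, ∑ z, A x z * A z y = 83 * (1 + (if x = y then 1 else 0)) - A x y)
    (σ : Equiv.Perm V) (hσ : σ ^ 21 = 1) (hF : (univ.filter fun x => (σ ^ 3) x = x).card = 25)
    (hA : ∀ x y, A (σ x) (σ y) = A x y) :
    8 * ((univ.filter fun x => σ x = x).card : ℤ) ≤ ((univ.filter fun x => (σ ^ 7) x = x).card : ℤ) + 66 := by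
  have hAk := adj_pow_invariant A σ hA
  have hρ : (σ ^ 3) ^ 7 = 1 := by rw [← pow_mul]; exact hσ
  have hcomm : σ * σ ^ 3 = σ ^ 3 * σ := by rw [← pow_succ', ← pow_succ]
  obtain ⟨-, hchar⟩ := aut_order7_fixed25_rank_tests hV A h01 hsymm hdiag hk hsrg (σ ^ 3) hρ (hAk 3) hF σ hcomm hA
    (by norm_num : 0 < 21) hσ
  -- counting facts
  have hmoved : (univ.filter fun x => (σ ^ 3) x ≠ x).card = 308 := by
    have h := Finset.card_filter_add_card_filter_not (s := (univ : Finset V)) (fun x => (σ ^ 3) x = x)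
    rw [Finset.card_univ, hV, hF] at h
    have : (univ.filter fun x => ¬ (σ ^ 3) x = x).card = 308 := by omega
    exact this
  have hfix2 : (univ.filter fun x => (σ ^ 7) x = x ∧ (σ ^ 3) x = x) = univ.filter fun x => σ x = x := by
    refine Finset.filter_congr fun x _ => ⟨fun h => perm_fixed_of_pow_coprime_o14 σ (by norm_num : Nat.Coprime 7 3)
      (by norm_num) h.1 h.2, fun h => ⟨Equiv.Perm.pow_apply_eq_self_of_apply_eq_self h 7,
        Equiv.Perm.pow_apply_eq_self_of_apply_eq_self h 3⟩⟩
  have hsplit := Finset.card_filter_add_card_filter_not (s := univ.filter fun x => (σ ^ 7) x = x) (fun x => (σ ^ 3) x = x)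
  rw [Finset.filter_filter, Finset.filter_filter, hfix2] at hsplit
  -- for 3 ∤ j: a σ³-moved x has σʲ x ∈ ⟨σ³⟩x iff σ⁷ x = x
  have hkey : ∀ j, ¬ 3 ∣ j → ∀ x, (σ ^ 3) x ≠ x →
      ((σ ^ j) x ∈ (Finset.range 7).image (fun k => ((σ ^ 3) ^ k) x) ↔ (σ ^ 7) x = x) := by
    intro j hj x hx
    constructor
    · intro hmem
      obtain ⟨k, hk7, hkx⟩ := Finset.mem_image.mp hmem
      rw [Finset.mem_range] at hk7
      by_contra h7
      have hn : (σ ^ (21 - 3 * k + j)) x = x := by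
        rw [pow_add, Equiv.Perm.mul_apply, ← hkx, ← pow_mul, ← Equiv.Perm.mul_apply, ← pow_add,
          Nat.sub_add_cancel (by omega : 3 * k ≤ 21), hσ, Equiv.Perm.one_apply]
      by_cases h7n : 7 ∣ 21 - 3 * k + j
      · obtain ⟨n', hn'⟩ := h7n
        have e1 : ((σ ^ 7) ^ n') x = x := by rw [← pow_mul, ← hn']; exact hn
        have e2 : ((σ ^ 7) ^ 3) x = x := by rw [← pow_mul, hσ, Equiv.Perm.one_apply]
        have hnd : ¬ 3 ∣ n' := by omega
        have hcop : Nat.Coprime n' 3 := ((Nat.Prime.coprime_iff_not_dvd (by norm_num : Nat.Prime 3)).mpr hnd).symm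
        exact h7 (perm_fixed_of_pow_coprime_o14 (σ ^ 7) hcop (by norm_num) e1 e2)
      · have hc3 : Nat.Coprime (21 - 3 * k + j) 3 :=
          ((Nat.Prime.coprime_iff_not_dvd (by norm_num : Nat.Prime 3)).mpr (by omega)).symm
        have hc7 : Nat.Coprime (21 - 3 * k + j) 7 :=
          ((Nat.Prime.coprime_iff_not_dvd (by norm_num : Nat.Prime 7)).mpr h7n).symm
        have hcop : Nat.Coprime (21 - 3 * k + j) 21 := Nat.Coprime.mul_right hc3 hc7
        have hfix : σ x = x :=
          perm_fixed_of_pow_coprime_o14 σ hcop (by norm_num) hn (by rw [hσ, Equiv.Perm.one_apply])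
        exact hx (Equiv.Perm.pow_apply_eq_self_of_apply_eq_self hfix 3)
    · intro h7
      have h14 : (σ ^ 14) x = x := by
        rw [show (14 : ℕ) = 7 * 2 by norm_num, pow_mul]; exact Equiv.Perm.pow_apply_eq_self_of_apply_eq_self h7 2
      have hdvd : 3 ∣ j + 14 * (j % 3) := by omega
      obtain ⟨K, hK⟩ := hdvd
      refine Finset.mem_image.mpr ⟨K % 7, Finset.mem_range.mpr (Nat.mod_lt _ (by norm_num)), ?_⟩
      show ((σ ^ 3) ^ (K % 7)) x = (σ ^ j) x
      rw [← perm_pow_apply_mod (σ ^ 3) hρ, ← pow_mul, ← hK, pow_add, Equiv.Perm.mul_apply, pow_mul,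
        Equiv.Perm.pow_apply_eq_self_of_apply_eq_self h14]
  -- the summands
  have hterm : ∀ j ∈ Finset.range 21,
      (((univ.filter fun x => (σ ^ 3) x ≠ x ∧ (σ ^ j) x ∈ (Finset.range 7).image (fun k => ((σ ^ 3) ^ k) x)).card : ℤ)
        - 7 * ((univ.filter fun x => (σ ^ j) x = x ∧ (σ ^ 3) x = x).card : ℤ))
      = if 3 ∣ j then (133 : ℤ) else
          ((univ.filter fun x => (σ ^ 7) x = x ∧ ¬ (σ ^ 3) x = x).card : ℤ) - 7 * ((univ.filter fun x => σ x = x).card : ℤ) := by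
    intro j _
    by_cases h3 : 3 ∣ j
    · rw [if_pos h3]
      obtain ⟨m, rfl⟩ := h3
      have e1 : (univ.filter fun x => (σ ^ 3) x ≠ x ∧ (σ ^ (3 * m)) x ∈ (Finset.range 7).image (fun k => ((σ ^ 3) ^ k) x))
          = univ.filter fun x => (σ ^ 3) x ≠ x := by
        refine Finset.filter_congr fun x _ => ⟨fun h => h.1, fun h => ⟨h, ?_⟩⟩
        refine Finset.mem_image.mpr ⟨m % 7, Finset.mem_range.mpr (Nat.mod_lt _ (by norm_num)), ?_⟩
        show ((σ ^ 3) ^ (m % 7)) x = (σ ^ (3 * m)) x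
        rw [← perm_pow_apply_mod (σ ^ 3) hρ, ← pow_mul]
      have e2 : (univ.filter fun x => (σ ^ (3 * m)) x = x ∧ (σ ^ 3) x = x) = univ.filter fun x => (σ ^ 3) x = x := by
        refine Finset.filter_congr fun x _ => ⟨fun h => h.2, fun h => ⟨?_, h⟩⟩
        rw [pow_mul]; exact Equiv.Perm.pow_apply_eq_self_of_apply_eq_self h m
      rw [e1, e2, hmoved, hF]; norm_num
    · rw [if_neg h3]
      have hcop3 : Nat.Coprime j 3 := ((Nat.Prime.coprime_iff_not_dvd (by norm_num : Nat.Prime 3)).mpr h3).symm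
      have e1 : (univ.filter fun x => (σ ^ 3) x ≠ x ∧ (σ ^ j) x ∈ (Finset.range 7).image (fun k => ((σ ^ 3) ^ k) x))
          = univ.filter fun x => (σ ^ 7) x = x ∧ ¬ (σ ^ 3) x = x :=
        Finset.filter_congr fun x _ => ⟨fun h => ⟨(hkey j h3 x h.1).mp h.2, h.1⟩, fun h => ⟨h.2, (hkey j h3 x h.2).mpr h.1⟩⟩
      have e2 : (univ.filter fun x => (σ ^ j) x = x ∧ (σ ^ 3) x = x) = univ.filter fun x => σ x = x :=
        Finset.filter_congr fun x _ => ⟨fun h => perm_fixed_of_pow_coprime_o14 σ hcop3 (by norm_num) h.1 h.2,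
          fun h => ⟨Equiv.Perm.pow_apply_eq_self_of_apply_eq_self h j, Equiv.Perm.pow_apply_eq_self_of_apply_eq_self h 3⟩⟩
      rw [e1, e2]
  rw [Finset.sum_congr rfl hterm, Finset.sum_ite, Finset.sum_const, Finset.sum_const] at hchar
  have hc3 : ((Finset.range 21).filter (fun j => 3 ∣ j)).card = 7 := by decide
  have hn3 : ((Finset.range 21).filter (fun j => ¬ 3 ∣ j)).card = 14 := by decide
  rw [hc3, hn3, nsmul_eq_mul, nsmul_eq_mul] at hchar
  simp only [Nat.cast_ofNat] at hchar
  omega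

end orders1421

end Summit.Ventures.DiscreteObjects.Hadamard
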